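import Summits.CriticalPhenomena.PercolationContinuityZ3.Theorems.PercNearOneGluingNoHeavyLowerTailAntitheticPrivAnchor
import HarnessLib

/-!
# `NoHeavyLowerTail` (stmt-CriticalPhenomena-4575) — antithetic cluster pairs: **THEOREM PR — THE RED-PRIVATE PART OF THE TOP EVENT IS
# NONNEGATIVE AT EVERY TARGET** (prim-hp-2 gen 75, HOME/THEOREM-PRIV.md §2 "THEOREM I / boosted TWD")

Support file (`--supports stmt-CriticalPhenomena-4575`, prim-hp-2 gen 75).  No definitions, no named facts, no sorries; standard axioms.
Notation of …AntitheticPrivAnchor (`X T`, `Y T` red/blue clusters of `s`; COMMON neighbour `v` of `s`: `Pv ∈ E`; PRIVATE: `Pv ∉ E`).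
THEOREM PR.  For EVERY finite graph `E`, every `s ≠ P` with `sP ∉ E` and all super-odd twisted-monotone `K₁, K₂`:
`0 ≤ Σ K₁(X T, Y T)·K₂(X T, Y T)` over the colourings `T` of the top event `{P ∈ X T, P ∉ Y T}` in which every PRIVATE pair `sv` is red.
THEOREM TWD (…AntitheticDomTopAll, `N(s) ⊆ N(P)`) is the case without private neighbours; the complementary part (some private pair blue)
is negative on its own, and CONJECTURE P1 (at most one private neighbour ⇒ the whole top event ≥ 0) is open (HOME/THEOREM-PRIV.md).
Proof = TWD's proof with the private pairs in the fixed set of every box: `Priv.top_rr_br_sum_nonneg` (some common red–red, some blue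
pair at `s`), anchor boxes `box_R` (`R ≠ ∅` common, `Y T = {s}`), pull-back `T ↦ T ∪ {sv : v ∈ R(T)}` keeping `X` (`Priv.red_eq_of_add`),
nested fibre `R = ∅`, THEOREM W (`PosPart.box_sum_ge_of_mem`) with red domination `Priv.dom_anchor_cmn`, and `Twin.kernel_anchor_ge_posPart`.
* `Antithetic.Priv.dom_anchor_cmn`, `Antithetic.Priv.top_sum_nonneg_priv` (THEOREM PR, `K`-form; the shift class is the instance
  `K = F⁺(X) − F⁻(Y)` as in `Dom.top_shift_sum_nonneg_dom`).
[cite: VandenbergHaggstromKahn2005, §1 p. 6 ("Harris' inequality"), §1 p. 3 (open cluster `C_s`)]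
-/

noncomputable section

namespace Summit.CriticalPhenomena.PercolationContinuityZ3.Theorems

open Literature.Probability.Percolation
open scoped Classical

namespace Antithetic

namespace Priv

variable {V : Type*}

section Clusters

variable {E : Set (Sym2 V)} {s P : V}

/-- **Red domination on an anchor box, dummy pairs free.**  As `Priv.dom_anchor`, but the pattern on the pairs `Pv` is imposed only for
COMMON neighbours `v` (`Pv ∈ E`); the pairs `Pv` towards private neighbours (not in `E`) are free like every other pair. [this work] -/
theorem dom_anchor_cmn {R : Set V} (hR : ∀ v ∈ R, v ≠ s ∧ v ≠ P ∧ s(s, v) ∈ E ∧ s(P, v) ∈ E) {j : V} (hj : j ∈ R)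
    {T T' : Set (Sym2 V)}
    (hTs : ∀ v, v ≠ s → v ≠ P → s(s, v) ∈ E → s(s, v) ∈ T)
    (hTP : ∀ v, v ≠ s → v ≠ P → s(s, v) ∈ E → s(P, v) ∈ E → (s(P, v) ∈ T ↔ v ∈ R))
    (hT's : ∀ v, v ≠ s → v ≠ P → s(s, v) ∈ E → s(s, v) ∈ T')
    (hflip : ∀ e : Sym2 V, (¬ ∃ v, (v ≠ s ∧ v ≠ P ∧ s(s, v) ∈ E) ∧ (e = s(s, v) ∨ (s(P, v) ∈ E ∧ e = s(P, v)))) →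
      (e ∈ T' ↔ e ∉ T)) :
    openCluster ((T' \ {e | ∃ v ∈ R, e = s(s, v)})ᶜ ∩ E) s ⊆ openCluster (T ∩ E) s := by
  have hPX : P ∈ openCluster (T ∩ E) s :=
    CommonNbr.mem_red_of_rr (hR j hj).1 (hR j hj).2.1 (hR j hj).2.2.1 (hR j hj).2.2.2 (hTs j (hR j hj).1 (hR j hj).2.1 (hR j hj).2.2.1)
      ((hTP j (hR j hj).1 (hR j hj).2.1 (hR j hj).2.2.1 (hR j hj).2.2.2).2 hj)
  refine TwoStage.Fan.cluster_subset_of_closed (mem_openCluster_self _ s) fun u w hu huw => ?_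
  obtain ⟨⟨hTb, hE⟩, hne⟩ := (openGraph_adj _ u w).1 huw
  by_cases hT'uw : s(u, w) ∈ T'
  · have hSuw : s(u, w) ∈ {e : Sym2 V | ∃ v ∈ R, e = s(s, v)} := by
      by_contra hn
      exact hTb ⟨hT'uw, hn⟩
    obtain ⟨v, hv, he⟩ := hSuw
    have hvX : v ∈ openCluster (T ∩ E) s :=
      Twin.mem_red_of_pair (mem_openCluster_self _ s) (hTs v (hR v hv).1 (hR v hv).2.1 (hR v hv).2.2.1) (hR v hv).2.2.1
        (hR v hv).1.symm
    have hw : w = s ∨ w = v := by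
      have : w ∈ s(s, v) := by rw [← he]; exact Sym2.mem_mk_right u w
      exact Sym2.mem_iff.1 this
    rcases hw with rfl | rfl
    · exact mem_openCluster_self _ _
    · exact hvX
  · by_cases hfix : ∃ v, (v ≠ s ∧ v ≠ P ∧ s(s, v) ∈ E) ∧ (s(u, w) = s(s, v) ∨ (s(P, v) ∈ E ∧ s(u, w) = s(P, v)))
    · obtain ⟨v, hv, he | ⟨-, he⟩⟩ := hfix
      · exact absurd (he ▸ hT's v hv.1 hv.2.1 hv.2.2) hT'uw
      · have hvX : v ∈ openCluster (T ∩ E) s :=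
          Twin.mem_red_of_pair (mem_openCluster_self _ s) (hTs v hv.1 hv.2.1 hv.2.2) hv.2.2 hv.1.symm
        have hw : w = P ∨ w = v := by
          have : w ∈ s(P, v) := by rw [← he]; exact Sym2.mem_mk_right u w
          exact Sym2.mem_iff.1 this
        rcases hw with rfl | rfl
        · exact hPX
        · exact hvX
    · have hTr : s(u, w) ∈ T := by
        by_contra h
        exact hT'uw ((hflip _ hfix).2 h)
      exact Twin.mem_red_of_pair hu hTr hE hne

end Clusters

variable [Fintype V]

/-- **THEOREM PR (the red-private part of the top event, every target, `K`-form).**  `s ≠ P`, `sP ∉ E`, NO hypothesis on the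
neighbourhoods.  Then for all super-odd twisted-monotone `K₁, K₂`:
`0 ≤ Σ_{T : P ∈ X T, P ∉ Y T, every private pair sv red} K₁(X T, Y T)·K₂(X T, Y T)`. [this work] -/
theorem top_sum_nonneg_priv (E : Set (Sym2 V)) (s P : V) (hsP : s ≠ P) (hsPE : s(s, P) ∉ E)
    {K₁ K₂ : Set V → Set V → ℝ}
    (hK₁ : ∀ ⦃A A' B B' : Set V⦄, A ⊆ A' → B' ⊆ B → K₁ A B ≤ K₁ A' B') (hso₁ : ∀ A B, 0 ≤ K₁ A B + K₁ B A)
    (hK₂ : ∀ ⦃A A' B B' : Set V⦄, A ⊆ A' → B' ⊆ B → K₂ A B ≤ K₂ A' B') (hso₂ : ∀ A B, 0 ≤ K₂ A B + K₂ B A) :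
    0 ≤ ∑ T ∈ Finset.univ.filter (fun T : Set (Sym2 V) => (P ∈ openCluster (T ∩ E) s ∧ P ∉ openCluster (Tᶜ ∩ E) s) ∧
        ∀ v, v ≠ s → v ≠ P → s(s, v) ∈ E → s(P, v) ∉ E → s(s, v) ∈ T),
      K₁ (openCluster (T ∩ E) s) (openCluster (Tᶜ ∩ E) s) * K₂ (openCluster (T ∩ E) s) (openCluster (Tᶜ ∩ E) s) := by
  let X : Set (Sym2 V) → Set V := fun T => openCluster (T ∩ E) s
  let Y : Set (Sym2 V) → Set V := fun T => openCluster (Tᶜ ∩ E) s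
  let f : Set (Sym2 V) → ℝ := fun T => K₁ (X T) (Y T) * K₂ (X T) (Y T)
  let nbr : V → Prop := fun v => v ≠ s ∧ v ≠ P ∧ s(s, v) ∈ E
  let cmn : V → Prop := fun v => v ≠ s ∧ v ≠ P ∧ s(s, v) ∈ E ∧ s(P, v) ∈ E
  let top : Set (Sym2 V) → Prop := fun T => P ∈ X T ∧ P ∉ Y T
  let cyl : Set (Sym2 V) → Prop := fun T => ∀ v, v ≠ s → v ≠ P → s(s, v) ∈ E → s(P, v) ∉ E → s(s, v) ∈ T
  let tc : Set (Sym2 V) → Prop := fun T => top T ∧ cyl T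
  let rr : Set (Sym2 V) → Prop := fun T => ∃ v, v ≠ s ∧ v ≠ P ∧ s(s, v) ∈ E ∧ s(P, v) ∈ E ∧ s(s, v) ∈ T ∧ s(P, v) ∈ T
  let br : Set (Sym2 V) → Prop := fun T => ∃ v, v ≠ s ∧ v ≠ P ∧ s(s, v) ∈ E ∧ s(s, v) ∉ T
  show 0 ≤ ∑ T ∈ Finset.univ.filter tc, f T
  have hXmono : Monotone X := fun T T' h => Freeze.openCluster_mono (Set.inter_subset_inter_left E h) s
  have hYanti : Antitone Y := fun T T' h => Freeze.openCluster_mono (Set.inter_subset_inter_left E (Set.compl_subset_compl.2 h)) s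
  have htc_mono : ∀ ⦃T T' : Set (Sym2 V)⦄, T ⊆ T' → tc T → tc T' :=
    fun T T' h hT => ⟨⟨hXmono h hT.1.1, fun h' => hT.1.2 (hYanti h h')⟩, fun v hvs hvP hvE hPvE => h (hT.2 v hvs hvP hvE hPvE)⟩
  rw [← Finset.sum_filter_add_sum_filter_not _ rr, Finset.filter_filter, Finset.filter_filter]
  rw [← Finset.sum_filter_add_sum_filter_not (Finset.univ.filter fun T => tc T ∧ rr T) br, Finset.filter_filter, Finset.filter_filter]
  have h1 : 0 ≤ ∑ T ∈ Finset.univ.filter (fun T => (tc T ∧ rr T) ∧ br T), f T := by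
    have h := top_rr_br_sum_nonneg E s P hK₁ hso₁ hK₂ hso₂
    have he : Finset.univ.filter (fun T => (tc T ∧ rr T) ∧ br T) =
        Finset.univ.filter (fun T : Set (Sym2 V) => P ∈ openCluster (T ∩ E) s ∧ P ∉ openCluster (Tᶜ ∩ E) s ∧
          (∃ v, v ≠ s ∧ v ≠ P ∧ s(s, v) ∈ E ∧ s(P, v) ∈ E ∧ s(s, v) ∈ T ∧ s(P, v) ∈ T) ∧
          (∃ v, v ≠ s ∧ v ≠ P ∧ s(s, v) ∈ E ∧ s(s, v) ∉ T) ∧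
          (∀ v, v ≠ s → v ≠ P → s(s, v) ∈ E → s(P, v) ∉ E → s(s, v) ∈ T)) := by
      ext T
      simp only [Finset.mem_filter, Finset.mem_univ, true_and]
      constructor
      · rintro ⟨⟨⟨⟨hPX, hPY⟩, hcyl⟩, hrr⟩, hbr⟩
        exact ⟨hPX, hPY, hrr, hbr, hcyl⟩
      · rintro ⟨hPX, hPY, hrr, hbr, hcyl⟩
        exact ⟨⟨⟨⟨hPX, hPY⟩, hcyl⟩, hrr⟩, hbr⟩
    rw [he]
    exact h
  rw [add_assoc]
  refine add_nonneg h1 ?_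
  let CM : Finset V := Finset.univ.filter cmn
  let Rfun : Set (Sym2 V) → Finset V := fun T => CM.filter fun v => s(P, v) ∈ T
  have hRmaps : ∀ T : Set (Sym2 V), Rfun T ∈ CM.powerset := fun T => Finset.mem_powerset.2 (Finset.filter_subset _ _)
  rw [← Finset.sum_fiberwise_of_maps_to (g := Rfun) (fun T _ => hRmaps T),
    ← Finset.sum_fiberwise_of_maps_to (g := Rfun) (s := Finset.univ.filter fun T => tc T ∧ ¬rr T) (fun T _ => hRmaps T),
    ← Finset.sum_add_distrib]
  refine Finset.sum_nonneg fun R hR => ?_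
  have hRCM : R ⊆ CM := Finset.mem_powerset.1 hR
  have hRcmn : ∀ v ∈ R, cmn v := fun v hv => (Finset.mem_filter.1 (hRCM hv)).2
  let boxR : Set (Sym2 V) → Prop := fun T => (∀ v, nbr v → s(s, v) ∈ T) ∧ (∀ v, cmn v → (s(P, v) ∈ T ↔ v ∈ R))
  let SR : Set (Sym2 V) := {e | ∃ v ∈ (R : Set V), e = s(s, v)}
  have hPnotSR : ∀ v, s(P, v) ∉ SR := by
    rintro v ⟨w, hw, he⟩
    rcases Sym2.eq_iff.1 he with ⟨h1, -⟩ | ⟨h1, -⟩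
    · exact hsP h1.symm
    · exact (hRcmn w hw).2.1 h1.symm
  have hred_or : ∀ T, tc T → ∀ v, nbr v → s(s, v) ∈ T ∨ (s(P, v) ∈ E ∧ s(P, v) ∈ T) := by
    intro T hT v hv
    by_cases hPvE : s(P, v) ∈ E
    · rcases CommonNbr.noBB_of_top hT.1.2 hv.1 hv.2.1 hv.2.2 hPvE with h | h
      · exact Or.inl h
      · exact Or.inr ⟨hPvE, h⟩
    · exact Or.inl (hT.2 v hv.1 hv.2.1 hv.2.2 hPvE)
  by_cases hR0 : R = ∅
  · have e2 : (Finset.univ.filter fun T => (tc T ∧ rr T) ∧ ¬br T).filter (fun T => Rfun T = R) = ∅ := by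
      refine Finset.filter_eq_empty_iff.2 fun T hT hTR => ?_
      obtain ⟨⟨-, v, hvs, hvP, hvE, hPvE, -, hPv⟩, -⟩ := (Finset.mem_filter.1 hT).2
      have : v ∈ Rfun T := Finset.mem_filter.2 ⟨Finset.mem_filter.2 ⟨Finset.mem_univ _, hvs, hvP, hvE, hPvE⟩, hPv⟩
      rw [hTR, hR0] at this
      exact Finset.notMem_empty v this
    rw [e2, Finset.sum_empty, zero_add]
    refine Finset.sum_nonneg fun T hT => ?_
    have hT' := Finset.mem_filter.1 hT
    obtain ⟨htc, -⟩ := (Finset.mem_filter.1 hT'.1).2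
    have hTR : Rfun T = R := hT'.2
    have hall : ∀ v, v ≠ s → s(s, v) ∈ E → s(s, v) ∈ T := by
      intro v hvs hvE
      have hvP : v ≠ P := fun h => hsPE (h ▸ hvE)
      rcases hred_or T htc v ⟨hvs, hvP, hvE⟩ with h | ⟨hPvE, h⟩
      · exact h
      · exfalso
        have : v ∈ Rfun T := Finset.mem_filter.2 ⟨Finset.mem_filter.2 ⟨Finset.mem_univ _, hvs, hvP, hvE, hPvE⟩, h⟩
        rw [hTR, hR0] at this
        exact Finset.notMem_empty v this
    have hY : Y T = {s} := Twin.blue_eq_singleton_of_red_at_source hall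
    have hsX : s ∈ X T := mem_openCluster_self _ s
    have ha1 : 0 ≤ K₁ (X T) {s} := (le_max_right _ _).trans (Twin.kernel_anchor_ge_posPart hK₁ hso₁ hsX (Set.mem_singleton s) (B := {s}))
    have ha2 : 0 ≤ K₂ (X T) {s} := (le_max_right _ _).trans (Twin.kernel_anchor_ge_posPart hK₂ hso₂ hsX (Set.mem_singleton s) (B := {s}))
    show 0 ≤ K₁ (X T) (Y T) * K₂ (X T) (Y T)
    rw [hY]
    exact mul_nonneg ha1 ha2
  obtain ⟨j, hj⟩ := Finset.nonempty_iff_ne_empty.2 hR0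
  have hjc : cmn j := hRcmn j hj
  have hboxPX : ∀ T, boxR T → P ∈ X T := fun T hT =>
    CommonNbr.mem_red_of_rr hjc.1 hjc.2.1 hjc.2.2.1 hjc.2.2.2 (hT.1 j ⟨hjc.1, hjc.2.1, hjc.2.2.1⟩) ((hT.2 j hjc).2 hj)
  have hboxY : ∀ T, boxR T → Y T = {s} := fun T hT =>
    Twin.blue_eq_singleton_of_red_at_source fun v hvs hvE =>
      hT.1 v ⟨hvs, fun h => hsPE (h ▸ hvE), hvE⟩
  have hboxtc : ∀ T, boxR T → tc T := fun T hT =>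
    ⟨⟨hboxPX T hT, by rw [hboxY T hT, Set.mem_singleton_iff]; exact fun h => hsP h.symm⟩,
      fun v hvs hvP hvE _ => hT.1 v ⟨hvs, hvP, hvE⟩⟩
  have e2 : (Finset.univ.filter fun T => (tc T ∧ rr T) ∧ ¬br T).filter (fun T => Rfun T = R) = Finset.univ.filter boxR := by
    ext T
    simp only [Finset.mem_filter, Finset.mem_univ, true_and]
    constructor
    · rintro ⟨⟨⟨-, -⟩, hnbr⟩, hTR⟩
      have hall : ∀ v, nbr v → s(s, v) ∈ T := fun v hv => by
        by_contra h
        exact hnbr ⟨v, hv.1, hv.2.1, hv.2.2, h⟩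
      refine ⟨hall, fun v hv => ?_⟩
      rw [← hTR]
      simp only [Rfun, CM, Finset.mem_filter, Finset.mem_univ, true_and]
      exact ⟨fun h => ⟨hv, h⟩, fun h => h.2⟩
    · intro hT
      refine ⟨⟨⟨hboxtc T hT, j, hjc.1, hjc.2.1, hjc.2.2.1, hjc.2.2.2, hT.1 j ⟨hjc.1, hjc.2.1, hjc.2.2.1⟩, (hT.2 j hjc).2 hj⟩, ?_⟩, ?_⟩
      · rintro ⟨v, hvs, hvP, hvE, hv⟩
        exact hv (hT.1 v ⟨hvs, hvP, hvE⟩)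
      · ext v
        simp only [Rfun, CM, Finset.mem_filter, Finset.mem_univ, true_and]
        constructor
        · rintro ⟨hv, h⟩; exact (hT.2 v hv).1 h
        · intro h; exact ⟨hRcmn v h, (hT.2 v (hRcmn v h)).2 h⟩
  have e3' : ∑ T ∈ (Finset.univ.filter boxR).filter (fun T => tc (T \ SR)), f (T \ SR) =
      ∑ T ∈ (Finset.univ.filter fun T => tc T ∧ ¬rr T).filter (fun T => Rfun T = R), f T := by
    refine Finset.sum_nbij' (fun T => T \ SR) (fun T₀ => T₀ ∪ SR) ?_ ?_ ?_ ?_ ?_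
    · intro T hT
      simp only [Finset.mem_filter, Finset.mem_univ, true_and] at hT ⊢
      obtain ⟨hbox, htc0⟩ := hT
      refine ⟨⟨htc0, ?_⟩, ?_⟩
      · rintro ⟨v, hvs, hvP, hvE, hPvE, hsv, hPv⟩
        have hvR : v ∈ R := (hbox.2 v ⟨hvs, hvP, hvE, hPvE⟩).1 hPv.1
        exact hsv.2 ⟨v, hvR, rfl⟩
      · ext v
        simp only [Rfun, CM, Finset.mem_filter, Finset.mem_univ, true_and, Set.mem_sdiff]
        constructor
        · rintro ⟨hv, hPv, -⟩; exact (hbox.2 v hv).1 hPv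
        · intro hv; exact ⟨hRcmn v hv, (hbox.2 v (hRcmn v hv)).2 hv, hPnotSR v⟩
    · intro T₀ hT₀
      simp only [Finset.mem_filter, Finset.mem_univ, true_and] at hT₀ ⊢
      obtain ⟨⟨htc0, hnrr⟩, hTR⟩ := hT₀
      have hdisj : ∀ e ∈ SR, e ∉ T₀ := by
        rintro e ⟨v, hv, rfl⟩ h
        have hvc : cmn v := hRcmn v hv
        have hPv : s(P, v) ∈ T₀ := by
          have hv' : v ∈ Rfun T₀ := by rw [hTR]; exact hv
          exact (Finset.mem_filter.1 hv').2
        exact hnrr ⟨v, hvc.1, hvc.2.1, hvc.2.2.1, hvc.2.2.2, h, hPv⟩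
      have hback : (T₀ ∪ SR) \ SR = T₀ := by
        ext e
        simp only [Set.mem_sdiff, Set.mem_union]
        constructor
        · rintro ⟨h | h, hn⟩
          · exact h
          · exact absurd h hn
        · intro h; exact ⟨Or.inl h, fun h' => hdisj e h' h⟩
      refine ⟨⟨fun v hv => ?_, fun v hv => ?_⟩, by rw [hback]; exact htc0⟩
      · by_cases hvR : v ∈ R
        · exact Or.inr ⟨v, hvR, rfl⟩
        · left
          rcases hred_or T₀ htc0 v hv with h | ⟨hPvE, h⟩
          · exact h
          · exfalso
            exact hvR (by rw [← hTR]; exact Finset.mem_filter.2 ⟨Finset.mem_filter.2 ⟨Finset.mem_univ _, hv.1, hv.2.1, hv.2.2, hPvE⟩, h⟩)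
      · simp only [Set.mem_union]
        constructor
        · rintro (h | h)
          · rw [← hTR]; exact Finset.mem_filter.2 ⟨Finset.mem_filter.2 ⟨Finset.mem_univ _, hv⟩, h⟩
          · exact absurd h (hPnotSR v)
        · intro hvR
          left
          rw [← hTR] at hvR
          exact (Finset.mem_filter.1 hvR).2
    · intro T hT
      simp only [Finset.mem_filter, Finset.mem_univ, true_and] at hT
      ext e
      simp only [Set.mem_union, Set.mem_sdiff]
      constructor
      · rintro (⟨h, -⟩ | h)
        · exact h
        · obtain ⟨v, hv, rfl⟩ := h
          exact hT.1.1 v ⟨(hRcmn v hv).1, (hRcmn v hv).2.1, (hRcmn v hv).2.2.1⟩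
      · intro h
        by_cases he : e ∈ SR
        · exact Or.inr he
        · exact Or.inl ⟨h, he⟩
    · intro T₀ hT₀
      simp only [Finset.mem_filter, Finset.mem_univ, true_and] at hT₀
      obtain ⟨⟨-, hnrr⟩, hTR⟩ := hT₀
      ext e
      simp only [Set.mem_sdiff, Set.mem_union]
      constructor
      · rintro ⟨h | h, hn⟩
        · exact h
        · exact absurd h hn
      · intro h
        refine ⟨Or.inl h, ?_⟩
        rintro ⟨v, hv, rfl⟩
        have hvc : cmn v := hRcmn v hv
        rw [← hTR] at hv
        have hPv : s(P, v) ∈ T₀ := (Finset.mem_filter.1 hv).2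
        exact hnrr ⟨v, hvc.1, hvc.2.1, hvc.2.2.1, hvc.2.2.2, h, hPv⟩
    · intro T hT; rfl
  have e3 : ∑ T ∈ (Finset.univ.filter fun T => tc T ∧ ¬rr T).filter (fun T => Rfun T = R), f T =
      ∑ T ∈ Finset.univ.filter boxR, (if tc (T \ SR) then f (T \ SR) else 0) := by
    rw [← e3', Finset.sum_filter]
    exact Finset.sum_congr rfl fun T _ => ite_congr rfl (fun _ => rfl) (fun _ => rfl)
  rw [e2, e3, ← Finset.sum_add_distrib]
  let Wb : Set (Sym2 V) → Set V := fun T => Y (T \ SR)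
  let u : Set (Sym2 V) → ℝ := fun T => if tc (T \ SR) then 1 else 0
  have hWb : Antitone Wb := fun T T' h => hYanti (Set.sdiff_subset_sdiff_left h)
  have hu0 : ∀ T, 0 ≤ u T := fun T => by simp only [u]; split_ifs <;> norm_num
  have hu1 : ∀ T, u T ≤ 1 := fun T => by simp only [u]; split_ifs <;> norm_num
  have hu : Monotone u := by
    intro T T' h
    simp only [u]
    by_cases hT : tc (T \ SR)
    · rw [if_pos hT, if_pos (htc_mono (Set.sdiff_subset_sdiff_left h) hT)]
    · rw [if_neg hT]; split_ifs <;> norm_num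
  have hsWb : ∀ T, s ∈ Wb T := fun T => mem_openCluster_self _ s
  have hsX : ∀ T, s ∈ X T := fun T => mem_openCluster_self _ s
  have hterm : ∀ T ∈ Finset.univ.filter boxR,
      u T * (max (K₁ (X T) (Wb T)) 0 * max (K₂ (X T) (Wb T)) 0) + u T * (K₁ (X T) (Wb T) * K₂ (X T) (Wb T)) ≤
      f T + (if tc (T \ SR) then f (T \ SR) else 0) := by
    intro T hT
    have hbox : boxR T := (Finset.mem_filter.1 hT).2
    have hY : Y T = {s} := hboxY T hbox
    have ha1 : max (K₁ (X T) (Wb T)) 0 ≤ K₁ (X T) {s} := Twin.kernel_anchor_ge_posPart hK₁ hso₁ (hsX T) (hsWb T)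
    have ha2 : max (K₂ (X T) (Wb T)) 0 ≤ K₂ (X T) {s} := Twin.kernel_anchor_ge_posPart hK₂ hso₂ (hsX T) (hsWb T)
    have hfT : f T = K₁ (X T) {s} * K₂ (X T) {s} := by simp only [f]; rw [hY]
    have hanchor : u T * (max (K₁ (X T) (Wb T)) 0 * max (K₂ (X T) (Wb T)) 0) ≤ f T := by
      rw [hfT]
      have hm : max (K₁ (X T) (Wb T)) 0 * max (K₂ (X T) (Wb T)) 0 ≤ K₁ (X T) {s} * K₂ (X T) {s} :=
        mul_le_mul ha1 ha2 (le_max_right _ _) ((le_max_right _ _).trans ha1)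
      have hm0 : 0 ≤ max (K₁ (X T) (Wb T)) 0 * max (K₂ (X T) (Wb T)) 0 := mul_nonneg (le_max_right _ _) (le_max_right _ _)
      nlinarith [hu0 T, hu1 T]
    have hpull : u T * (K₁ (X T) (Wb T) * K₂ (X T) (Wb T)) = (if tc (T \ SR) then f (T \ SR) else 0) := by
      simp only [u]
      by_cases ht : tc (T \ SR)
      · rw [if_pos ht, if_pos ht, one_mul]
        have hXeq : X T = X (T \ SR) := by
          refine red_eq_of_add (S := SR) (fun e he => ?_) Set.sdiff_subset (fun e he => by
            by_cases h : e ∈ SR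
            · exact Or.inr h
            · exact Or.inl ⟨he, h⟩)
          obtain ⟨v, hv, rfl⟩ := he
          have hvc : cmn v := hRcmn v hv
          have hPv : s(P, v) ∈ T \ SR := ⟨(hbox.2 v hvc).2 hv, hPnotSR v⟩
          exact ⟨v, Twin.mem_red_of_pair ht.1.1 hPv hvc.2.2.2 hvc.2.1.symm, rfl⟩
        simp only [f, Wb]
        rw [hXeq]
      · rw [if_neg ht, if_neg ht, zero_mul]
    linarith
  refine le_trans ?_ (Finset.sum_le_sum hterm)
  let Fix : Set (Sym2 V) := {e | ∃ v, nbr v ∧ (e = s(s, v) ∨ (s(P, v) ∈ E ∧ e = s(P, v)))}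
  let Npat : Set (Sym2 V) := {e | ∃ v, nbr v ∧ (e = s(s, v) ∨ (s(P, v) ∈ E ∧ e = s(P, v) ∧ v ∈ R))}
  have hNs : ∀ v, nbr v → s(s, v) ∈ Npat := fun v hv => ⟨v, hv, Or.inl rfl⟩
  have hNP : ∀ v, cmn v → (s(P, v) ∈ Npat ↔ v ∈ R) := by
    intro v hv
    constructor
    · rintro ⟨w, hw, h | ⟨-, h, hwR⟩⟩
      · exfalso
        have : s ∈ s(P, v) := by rw [h]; exact Sym2.mem_mk_left s w
        rcases Sym2.mem_iff.1 this with h' | h'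
        · exact hsP h'
        · exact hv.1 h'.symm
      · have : w ∈ s(P, v) := by rw [h]; exact Sym2.mem_mk_right P w
        rcases Sym2.mem_iff.1 this with h' | h'
        · exact absurd h' hw.2.1
        · rw [← h']; exact hwR
    · intro hvR; exact ⟨v, ⟨hv.1, hv.2.1, hv.2.2.1⟩, Or.inr ⟨hv.2.2.2, rfl, hvR⟩⟩
  have hbox_iff : ∀ T : Set (Sym2 V), (∀ e ∈ Fix, (e ∈ T ↔ e ∈ Npat)) ↔ boxR T := by
    intro T
    constructor
    · intro h
      refine ⟨fun v hv => (h _ ⟨v, hv, Or.inl rfl⟩).2 (hNs v hv), fun v hv => ?_⟩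
      rw [h _ ⟨v, ⟨hv.1, hv.2.1, hv.2.2.1⟩, Or.inr ⟨hv.2.2.2, rfl⟩⟩]
      exact hNP v hv
    · rintro ⟨h1, h2⟩ e ⟨v, hv, he | ⟨hPvE, he⟩⟩
      · rw [he]; exact ⟨fun _ => hNs v hv, fun _ => h1 v hv⟩
      · rw [he, h2 v ⟨hv.1, hv.2.1, hv.2.2, hPvE⟩, hNP v ⟨hv.1, hv.2.1, hv.2.2, hPvE⟩]
  have hD : ∀ T, T ∈ Finset.univ.filter boxR ↔ ∀ e ∈ Fix, (e ∈ T ↔ e ∈ Npat) := fun T => by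
    rw [Finset.mem_filter, hbox_iff T]
    exact ⟨fun h => h.2, fun h => ⟨Finset.mem_univ _, h⟩⟩
  have hW := PosPart.box_sum_ge_of_mem Fix Npat (Finset.univ.filter boxR) hD X Wb hXmono hWb (fun T T' hT hT' hflip => ?_)
    hK₁ hso₁ hK₂ hso₂ hu0 hu
  · have hsplit : ∀ T : Set (Sym2 V), u T * (max (K₁ (X T) (Wb T)) 0 * max (K₂ (X T) (Wb T)) 0) + u T * (K₁ (X T) (Wb T) * K₂ (X T) (Wb T)) =
        (u T * (K₁ (X T) (Wb T) * K₂ (X T) (Wb T)) -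
          u T * (max (-K₁ (X T) (Wb T)) 0 * max (-K₂ (X T) (Wb T)) 0 - max (K₁ (X T) (Wb T)) 0 * max (K₂ (X T) (Wb T)) 0)) +
        u T * (max (-K₁ (X T) (Wb T)) 0 * max (-K₂ (X T) (Wb T)) 0) := fun T => by ring
    rw [Finset.sum_congr rfl fun T _ => hsplit T, Finset.sum_add_distrib, Finset.sum_sub_distrib]
    have hnn : 0 ≤ ∑ T ∈ Finset.univ.filter boxR, u T * (max (-K₁ (X T) (Wb T)) 0 * max (-K₂ (X T) (Wb T)) 0) :=
      Finset.sum_nonneg fun T _ => mul_nonneg (hu0 T) (mul_nonneg (le_max_right _ _) (le_max_right _ _))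
    exact add_nonneg (sub_nonneg.2 hW) hnn
  · have hb : boxR T := (hbox_iff T).1 hT
    have hb' : boxR T' := (hbox_iff T').1 hT'
    exact dom_anchor_cmn (R := (R : Set V)) (fun v hv => hRcmn v hv) (j := j) hj
      (fun v hvs hvP hvE => hb.1 v ⟨hvs, hvP, hvE⟩) (fun v hvs hvP hvE hPvE => hb.2 v ⟨hvs, hvP, hvE, hPvE⟩)
      (fun v hvs hvP hvE => hb'.1 v ⟨hvs, hvP, hvE⟩) fun e he => hflip e he

end Priv

end Antithetic

end Summit.CriticalPhenomena.PercolationContinuityZ3.Theorems
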